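import Summits.BirchSwinnertonDyer.BirchSwinnertonDyer.Theorems.GoldfeldAllTwistsTwoConverseTwinGenusDescentKodaira
import Summits.BirchSwinnertonDyer.BirchSwinnertonDyer.Theorems.Rank2ObservatoryRootNumberLocal
import Literature.NumberTheory.EllipticCurves.PastenValuationProductThm115Proofs
import Literature.NumberTheory.EllipticCurves.TamagawaRingEquivProofs
import Literature.NumberTheory.GaloisRepresentations.ArtinDirichletCoefficients
import HarnessLib

set_option linter.dupNamespace false -- `…BirchSwinnertonDyer.BirchSwinnertonDyer…` is the cell's namespace (D-0017)
set_option autoImplicit false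

/-!
# LINE B49 — the FIXED partner curves, IX: `Tam(W₇₈₄) = c₂ · c₇ = 2 · c₂ ∈ {4, 8}` (kernel assembly)

Cell `bsd-goldfeld`, seat `bsd-goldfeld-s1p-c301` (prover, gen 6); TARGET v5.5 §2 c301 (g) W-A5; support for
item `stmt-BirchSwinnertonDyer-19140`. HONEST FRAMING: kernel theorems about `W₇₈₄ = [0, −21, 0, 112, 0]`;
nothing about BSD; not in the Theses cone. The Tamagawa product of `W₇₈₄` is assembled IN THE KERNEL
from file VIII's local data: the bad places of `ℤ` are those above `2` and `7` (`Δ = −2¹²·7³`,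
`hasGoodReductionAt_of_not_dvd`), the product formula `tamagawaProduct_eq_prod` (Pasten–Shimura file;
`p`-adic local numbers, bridged to the `𝓞 ℚ`-place numbers by `localTamagawaNumber_padic_eq_holds` — the
dependent prime `primesEquiv v` is generalised away in `localTamagawaNumber_padic_W784_eq`), `c₇ = 2`
(type `III`) and `c₂ ∈ {2, 4}` (type `I₄*`): **`tamagawaProduct_W784_eq_or : Tam(W₇₈₄) = 4 ∨ Tam(W₇₈₄) = 8`**.
So the named input `X049Partner784TamagawaEight` (file VII, the printed value `8`) is now exactly the
one bit «`c₂(W₇₈₄) = 4`, not `2`» of Tate's Step 7 for `I₄*` (route recorded in file VIII's docstring: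
the rational points `T`, `g₇₈₄` are of side `D` and `g₇₈₄ + T` of side `S`).
References: [Silverman1994] IV.9.4, Table 4.1; [SilvermanAEC2009] VII.5.1; [CremonaAlgorithms1997] Table 1.
-/

noncomputable section

open scoped Classical NumberField

open WeierstrassCurve IsDedekindDomain Rat.HeightOneSpectrum
  Literature.NumberTheory.EllipticCurves
  Summit.BirchSwinnertonDyer.BirchSwinnertonDyer.Rank2Observatory.RootNumber

namespace Summit.BirchSwinnertonDyer.BirchSwinnertonDyer.Theorems.GoldfeldGoodTwists

/-- `Δ([0, −21, 0, 112, 0]) = −2¹²·7³`: a prime dividing it is `2` or `7`. [folklore] -/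
theorem eq_two_or_seven_of_dvd_Δ_W784 {p : ℕ} (hp : p.Prime)
    (h : (p : ℤ) ∣ (⟨0, -21, 0, 112, 0⟩ : WeierstrassCurve ℤ).Δ) : p = 2 ∨ p = 7 := by
  rw [invariants_twoTorsionModel_neg_one.2.2, dvd_neg] at h
  have h' : p ∣ 2 ^ 12 * 7 ^ 3 := by exact_mod_cast h
  rcases (Nat.Prime.dvd_mul hp).mp h' with h2 | h7
  · exact Or.inl ((Nat.prime_dvd_prime_iff_eq hp Nat.prime_two).mp (hp.dvd_of_dvd_pow h2))
  · exact Or.inr ((Nat.prime_dvd_prime_iff_eq hp (by norm_num)).mp (hp.dvd_of_dvd_pow h7))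

/-- The `p`-adic local Tamagawa number of `W₇₈₄` at a place `v` of `ℤ`, as a function of `v`
(the factor of `tamagawaProduct_eq_prod`). [folklore] -/
theorem localTamagawaNumber_padic_W784_eq (v : HeightOneSpectrum ℤ) (p : ℕ) [hp : Fact p.Prime]
    (hv : (primesEquiv v : ℕ) = p) (c : ℕ)
    (hc : ∀ w : HeightOneSpectrum (𝓞 ℚ), natGenerator w = p →
      ((⟨0, -21, 0, 112, 0⟩ : WeierstrassCurve ℚ).baseChange (w.adicCompletion ℚ)).localTamagawaNumber
        (w.adicCompletionIntegers ℚ) = c) :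
    (haveI := Fact.mk (primesEquiv v).2
     ((⟨0, -21, 0, 112, 0⟩ : WeierstrassCurve ℚ).baseChange ℚ_[primesEquiv v]).localTamagawaNumber
       ℤ_[primesEquiv v]) = c := by
  haveI := isElliptic_twoTorsionModel_neg_one
  -- replace the dependent prime `primesEquiv v` by `p`
  obtain ⟨q, hq⟩ : ∃ q : Nat.Primes, primesEquiv v = q := ⟨_, rfl⟩
  have hqp : (q : ℕ) = p := by rw [← hq]; exact hv
  rw [hq]
  obtain ⟨q, hq'⟩ := q
  simp only at hqp
  subst hqp
  -- the place of `𝓞 ℚ` above `p`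
  set w : HeightOneSpectrum (𝓞 ℚ) := (primesEquiv (R := 𝓞 ℚ)).symm ⟨q, hq'⟩ with hw
  have hwq : (primesEquiv w : ℕ) = q := by rw [hw, Equiv.apply_symm_apply]
  have key := localTamagawaNumber_padic_eq_holds (⟨0, -21, 0, 112, 0⟩ : WeierstrassCurve ℚ) w q hwq
  have hgen : natGenerator w = q := by
    rw [hw]; exact Literature.NumberTheory.GaloisRepresentations.Rat.natGenerator_primesEquiv_symm ⟨q, hq'⟩
  have e : (Fact.mk hq' : Fact (Nat.Prime q)) = hp := Subsingleton.elim _ _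
  subst e
  rw [key]
  exact hc w hgen

/-- **`Tam(W₇₈₄) = 2 · c₂`** where `c₂ ∈ {2, 4}` is the local Tamagawa number at the place above `2`:
the bad places of `W₇₈₄ = [0, −21, 0, 112, 0]` are `2` and `7` (`Δ = −2¹²·7³`), `c₇ = 2` (file VIII,
type `III`), product formula `tamagawaProduct_eq_prod`. Hence **`Tam(W₇₈₄) ∈ {4, 8}`**; the printed value
`8` is the named input `X049Partner784TamagawaEight` (file VII), now EQUIVALENT to `c₂ = 4`.
[cite: Silverman1994, IV.9.4 and Table 4.1] [cite: CremonaAlgorithms1997, Table 1 (N = 784)] -/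
theorem tamagawaProduct_W784_eq_or :
    (⟨0, -21, 0, 112, 0⟩ : WeierstrassCurve ℚ).tamagawaProduct = 4 ∨
      (⟨0, -21, 0, 112, 0⟩ : WeierstrassCurve ℚ).tamagawaProduct = 8 := by
  haveI := isElliptic_twoTorsionModel_neg_one
  set v₂ : HeightOneSpectrum ℤ := (primesEquiv (R := ℤ)).symm ⟨2, Nat.prime_two⟩ with hv₂
  set v₇ : HeightOneSpectrum ℤ := (primesEquiv (R := ℤ)).symm ⟨7, by norm_num⟩ with hv₇
  have h2 : (primesEquiv v₂ : ℕ) = 2 := by rw [hv₂, Equiv.apply_symm_apply]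
  have h7 : (primesEquiv v₇ : ℕ) = 7 := by rw [hv₇, Equiv.apply_symm_apply]
  have hne : v₂ ≠ v₇ := by
    intro h; have := congrArg (fun v => (primesEquiv v : ℕ)) h; simp only [h2, h7] at this; omega
  have hprod := tamagawaProduct_eq_prod (⟨0, -21, 0, 112, 0⟩ : WeierstrassCurve ℚ) {v₂, v₇} (by
    intro v hv
    by_contra hmem
    apply hv
    rw [twoTorsionModel_neg_one_eq_baseChange]
    refine hasGoodReductionAt_of_not_dvd fun hdvd => hmem ?_
    rcases eq_two_or_seven_of_dvd_Δ_W784 (prime_natGenerator v) hdvd with h | h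
    · have : v = v₂ := by
        apply (primesEquiv (R := ℤ)).injective
        exact Subtype.ext (by rw [h2]; exact h)
      simp [this]
    · have : v = v₇ := by
        apply (primesEquiv (R := ℤ)).injective
        exact Subtype.ext (by rw [h7]; exact h)
      simp [this])
  rw [Finset.prod_pair hne] at hprod
  haveI : Fact (Nat.Prime 2) := ⟨Nat.prime_two⟩
  haveI : Fact (Nat.Prime 7) := ⟨by norm_num⟩
  have c7 := localTamagawaNumber_padic_W784_eq v₇ 7 h7 2 (fun w hw => localTamagawaNumber_W784_seven w hw)
  -- `c₂ ∈ {2, 4}`: pick the place of `𝓞 ℚ` above `2` to decide which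
  set w₂ : HeightOneSpectrum (𝓞 ℚ) := (primesEquiv (R := 𝓞 ℚ)).symm ⟨2, Nat.prime_two⟩ with hw₂
  have hgen : natGenerator w₂ = 2 := by
    rw [hw₂]; exact Literature.NumberTheory.GaloisRepresentations.Rat.natGenerator_primesEquiv_symm ⟨2, _⟩
  -- all places above `2` give the same local number (it is the `2`-adic one)
  have huniq : ∀ (c : ℕ), ((⟨0, -21, 0, 112, 0⟩ : WeierstrassCurve ℚ).baseChange
      (w₂.adicCompletion ℚ)).localTamagawaNumber (w₂.adicCompletionIntegers ℚ) = c →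
      ∀ w : HeightOneSpectrum (𝓞 ℚ), natGenerator w = 2 →
        ((⟨0, -21, 0, 112, 0⟩ : WeierstrassCurve ℚ).baseChange (w.adicCompletion ℚ)).localTamagawaNumber
          (w.adicCompletionIntegers ℚ) = c := by
    intro c hc w hw
    have hww : w = w₂ := by
      apply (primesEquiv (R := 𝓞 ℚ)).injective
      exact Subtype.ext (hw.trans hgen.symm)
    rw [hww]; exact hc
  rcases localTamagawaNumber_W784_two w₂ hgen with hc2 | hc4
  · left
    have c2 := localTamagawaNumber_padic_W784_eq v₂ 2 h2 2 (huniq 2 hc2)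
    rw [hprod, c2, c7]
    norm_num
  · right
    have c2 := localTamagawaNumber_padic_W784_eq v₂ 2 h2 4 (huniq 4 hc4)
    rw [hprod, c2, c7]
    norm_num

end Summit.BirchSwinnertonDyer.BirchSwinnertonDyer.Theorems.GoldfeldGoodTwists

end
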